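import Summits.RiemannHypothesis.RiemannHypothesis.Theses.ScrewInnovationDivisorLaw
import HarnessLib

/-!
# `ScrewInnovationDivisorLaw.Assembly` (item stmt-RiemannHypothesis-23160) — glue closer

`DivisorLawCertifiedRange` (6 ≤ M ≤ 128) and `DivisorLawTail` (128 < M) give `DivisorLaw` (6 ≤ M) by the
case split `le_or_gt M 128`.
Cell rh-split (typer-3 g3 glue sweep, RULING #374).  Pure propositional glue; no analysis.
Nothing here bears on the truth of RH.
-/

set_option linter.dupNamespace false  -- the mandated namespace repeats `RiemannHypothesis`

namespace Summit.RiemannHypothesis.RiemannHypothesis.Theorems.ScrewInnovationDivisorLaw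

/-- **`Assembly` (item stmt-RiemannHypothesis-23160) holds**: certified range `M ≤ 128` plus tail
`128 < M` cover every `M ≥ 6`. [folklore] -/
theorem assembly_proof : Summit.RiemannHypothesis.RiemannHypothesis.Theses.ScrewInnovationDivisorLaw.Assembly := by
  intro h1 h2 M h6
  rcases le_or_gt M 128 with h | h
  · exact h1 M h6 h
  · exact h2 M h

end Summit.RiemannHypothesis.RiemannHypothesis.Theorems.ScrewInnovationDivisorLaw
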